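import Literature.Probability.RandomPlanarGeometry.StationaryAngleLawExistence
import Literature.Probability.RandomPlanarGeometry.DrivingIncrementAC
import Literature.Probability.Process.BrownianPair
import HarnessLib

/-!
# Uniqueness of the stationary SLE_κ(0) angle law (`0 < κ ≤ 4`); `IsStationaryAngleLaw.exists_unique`

Topic `Probability/RandomPlanarGeometry`; auxiliary definitions with bodies (`stopPair`,
`flowStopPair`, `pathStopPair`, `restrictPath`, the exit data `bandWidth`, `bandExitTime`, `drivingIncr`,
`clockCap`, `concatBM`) and proved theorems; it DISCHARGES the named fact
`IsStationaryAngleLaw.exists_unique` (`WholePlaneSLE`; Miller–Sheffield (2013), Prop. 2.1) as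
`IsStationaryAngleLaw.exists_unique_holds`.

**Uniqueness in law of the stationary solution** (the reduced case `ρ = 0`, `0 < κ ≤ 4`, to which
`exists_unique_of_rho_zero` reduces the fact). Let `P` be any stationary SLE_κ(0) angle law
(`IsStationaryAngleLaw κ 0 P`): the coordinate process `X` lives in `(0, 2π)`, `P` is shift
invariant, and `P` solves the martingale problem of `L₀ = (κ/2)∂² + cot(·/2)∂`. We prove that the
law under `P` of the path `(X_u)_{u ≥ 0}` is the flow law `flowLaw κ m` of the SLE_κ radial Bessel
flow started from the time-`0` marginal `m` (`map_restrictPath_eq_flowLaw`):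

1. *Brownian driving noise.* By the martingale problem (no change of measure is needed at `ρ = 0`),
   the normalised driving increment `ξ_t/√κ`, `ξ_t = X_t - X_0 - ∫₀ᵗ cot(X_u/2) du`, stopped at the
   exit time `τ_n` of `[2ε_n, 2π - 2ε_n]` and frozen after `T`, carries a martingale clock
   (`hasMartingaleClock_drivingIncrement_of_martingale`, Karatzas–Shreve (1988), Ch. 5 Prop. 4.6),
   also under every conditioned measure `P[· | X_0 ∈ A]` (conditioning on an `ℱ_0`-event preserves
   the martingale problem); concatenated with an independent Brownian motion it is a Brownian
   motion `M` (`isBrownianReal_concat`, Revuz–Yor (1999), Ch. V Thm (1.7)). Hence the pair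
   `(X_0, M)` has the product law `m ⊗ 𝓦` (`map_pair_concatBM_eq`).
2. *Flow identity.* On `{|X - π| ≤ π - 2ε_n on [0, T]}` the path solves
   `X_t = X_0 + ∫₀ᵗ cot(X_u/2) du - √κ M_t` on `[0, T]`, so by uniqueness for the integrated
   equation it IS the universal radial Bessel flow `pathArg κ X_0 · M` there
   (`eq_pathArg_of_integral_eq`).
3. *Limit.* These events exhaust the path space as `n → ∞`; so the law of `(X_0, X_{·∧T})` is the
   image of `m ⊗ 𝓦` under the stopped universal flow, i.e. that of the SLE_κ flow started from `m`
   (`map_stopPair_eq`), and the finite-dimensional laws of `(X_u)_{u ≥ 0}` are those of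
   `flowLaw κ m`.

Consequences: the marginal `m` is invariant for the transition kernels (stationarity), hence is
THE invariant probability measure (`invariant_sleKernel_unique`); two stationary laws therefore
have the same one-sided law, the same clamps, and coincide (`Measure.ext_of_map_clampPath`):
`isStationaryAngleLaw_unique`. With `exists_isStationaryAngleLaw_rho_zero` this gives
`exists_unique_rho_zero`, and `IsStationaryAngleLaw.exists_unique_holds` by
`exists_unique_of_rho_zero` (time scaling).

## References

* J. Miller, S. Sheffield, *Imaginary geometry IV*, PTRF 169 (2017), arXiv:1302.4738, §2.1.2,
  Prop. 2.1. [MillerSheffield2013]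
* I. Karatzas, S. Shreve, *Brownian Motion and Stochastic Calculus* (1988), Ch. 5 §4.B,
  Prop. 4.6, Cor. 4.8–4.9 (martingale problem and weak solutions). [KaratzasShreve1988]
* D. Revuz, M. Yor, *Continuous Martingales and Brownian Motion* (1999), Ch. V Thm (1.7),
  Ch. IX §1 (pathwise uniqueness ⟹ uniqueness in law). [RevuzYor1999]
-/

noncomputable section

open MeasureTheory ProbabilityTheory Filter Topology Set
open scoped NNReal ENNReal

namespace Literature.Probability.RandomPlanarGeometry

open scoped PathBorel
open Literature.Probability.Process RadialLoewner Real

variable {κ : ℝ≥0}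

/-! ### Deterministic: the integrated angle equation determines the path (universal flow) -/

section FlowIdentity

/-- **Uniqueness for the integrated angle equation.** A continuous path `y` with
`|y - π| ≤ π - 2ε` on `[0, T]` solving `y_u = y_0 + ∫₀ᵘ cot(y_r/2) dr - √κ (w_u - w_0)` on `[0, T]`
for a continuous raw path `w` is, on `[0, T]`, the universal radial Bessel flow `pathArg κ y₀ · w`
(the truncated flows of all small levels agree with `y`, `eqOn_argTrunc_of_integral_eq`, and the
maximal flow is the truncated one before the exit of the level band). [folklore] -/
theorem eq_pathArg_of_integral_eq {w : ℝ≥0 → ℝ} (hw : Continuous w) {y : ℝ≥0 → ℝ}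
    (hy : Continuous y) {ε : ℝ} (hε : 0 < ε) (hε2 : ε ≤ π / 2) {T : ℝ≥0}
    (hband : ∀ u : ℝ≥0, u ≤ T → |y u - π| ≤ π - 2 * ε)
    (heq : ∀ u : ℝ≥0, u ≤ T → y u = y 0 + (∫ r in (0 : ℝ)..u, Real.cot (y r.toNNReal / 2)) -
      Real.sqrt κ * (w u - w 0)) :
    ∀ u : ℝ≥0, u ≤ T → y u = pathArg κ (y 0) u w := by
  have hmem : ∀ u : ℝ≥0, u ≤ T → y u / 2 ∈ Icc ε (π - ε) := fun u hu ↦ by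
    have h := hband u hu
    rw [abs_le] at h
    constructor <;> linarith [h.1, h.2]
  -- `y` is the level-`ε` truncated flow
  have h1 : ∀ u : ℝ≥0, u ≤ T → y u = argTrunc (pathDriving κ) ε (continuous_pathDriving κ) hε hε2 (y 0) u w := by
    refine eqOn_argTrunc_of_integral_eq (continuous_pathDriving κ) hε hε2 (y 0) w hy fun s hs ↦ ?_
    rw [pathDriving_of_continuous hw, pathDriving_of_continuous hw, heq s hs, ← mul_sub]
    congr 2
    refine intervalIntegral.integral_congr fun r hr ↦ ?_
    rw [uIcc_of_le (NNReal.coe_nonneg s)] at hr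
    have hr' : r.toNNReal ≤ T := (Real.toNNReal_le_iff_le_coe.2 hr.2).trans hs
    exact (cotTrunc_eq_cot (hmem _ hr')).symm
  -- a level below `ε`
  obtain ⟨n, hn⟩ : ∃ n : ℕ, level n < ε := (tendsto_level.eventually (Iio_mem_nhds hε)).exists
  have h2 : ∀ u : ℝ≥0, u ≤ T → argTrunc (pathDriving κ) (level n) (continuous_pathDriving κ)
      (level_pos n) (level_le n) (y 0) u w =
      argTrunc (pathDriving κ) ε (continuous_pathDriving κ) hε hε2 (y 0) u w :=
    argTrunc_eq_argTrunc_of_forall_mem (continuous_pathDriving κ) hε hε2 (level_pos n) (level_le n)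
      hn.le (y 0) w fun s hs ↦ by
        rw [← h1 s hs]
        have h := hband s hs
        rw [abs_le] at h
        constructor <;> linarith [h.1, h.2]
  have h3 : ((T : ℝ≥0) : WithTop ℝ≥0) < exitLevel (pathDriving κ) (continuous_pathDriving κ) n (y 0) w := by
    refine lt_truncExit_of_forall_mem (continuous_pathDriving κ) (level_pos n) (level_le n) (y 0) w
      fun s hs ↦ ?_
    rw [h2 s hs, ← h1 s hs]
    have h := hband s hs
    rw [abs_le] at h
    constructor <;> linarith [h.1, h.2]
  intro u hu
  rw [pathArg, arg_eq_argLevel (continuous_pathDriving κ) ((WithTop.coe_le_coe.2 hu).trans h3.le),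
    argLevel, h2 u hu, ← h1 u hu]

end FlowIdentity

/-! ### The stopped pair maps -/

section Pairs

variable (κ)

/-- **The initial value and the path frozen after `T`** of a two-sided path, read on `[0, ∞)`:
`stopPair T x = (x 0, u ↦ x(u ∧ T))`. [folklore] -/
def stopPair (T : ℝ≥0) (x : C(ℝ, ℝ)) : ℝ × (ℝ≥0 → ℝ) := (x 0, fun u ↦ x (min (u : ℝ) T))

/-- The same pair for the SLE_κ radial Bessel flow on the canonical space:
`(θ, ω) ↦ (θ, u ↦ Y^θ_{u ∧ T}(ω))`. [folklore] -/
def flowStopPair (T : ℝ≥0) (p : ℝ × (ℝ≥0 → ℝ)) : ℝ × (ℝ≥0 → ℝ) :=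
  (p.1, fun u ↦ sleArg κ p.1 (min u T) p.2)

/-- The same pair for the universal flow on the raw path space. [folklore] -/
def pathStopPair (T : ℝ≥0) (q : ℝ × (ℝ≥0 → ℝ)) : ℝ × (ℝ≥0 → ℝ) :=
  (q.1, fun u ↦ pathArg κ q.1 (min u T) q.2)

/-- **Restriction of a two-sided path to `[0, ∞)`.** [folklore] -/
def restrictPath (x : C(ℝ, ℝ)) : C(ℝ≥0, ℝ) := x.comp ⟨fun u : ℝ≥0 ↦ (u : ℝ), NNReal.continuous_coe⟩

variable {κ}

/-- Value of the restricted path. [folklore] -/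
@[simp] theorem restrictPath_apply (x : C(ℝ, ℝ)) (u : ℝ≥0) : restrictPath x u = x u := rfl

/-- The restriction is measurable. [folklore] -/
theorem measurable_restrictPath : Measurable restrictPath :=
  measurable_of_eval_oneSided fun u ↦ (continuous_eval_const (u : ℝ)).measurable

/-- `stopPair` is measurable. [folklore] -/
theorem measurable_stopPair (T : ℝ≥0) : Measurable (stopPair T) :=
  (continuous_eval_const (0 : ℝ)).measurable.prodMk
    (measurable_pi_lambda _ fun u ↦ (continuous_eval_const (min (u : ℝ) (T : ℝ))).measurable)

variable (κ) in
/-- `flowStopPair` is measurable. [folklore] -/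
theorem measurable_flowStopPair (T : ℝ≥0) : Measurable (flowStopPair κ T) :=
  measurable_fst.prodMk (measurable_pi_lambda _ fun u ↦ measurable_sleArg_prod κ (min u T))

variable (κ) in
/-- `pathStopPair` is measurable. [folklore] -/
theorem measurable_pathStopPair (T : ℝ≥0) : Measurable (pathStopPair κ T) :=
  measurable_fst.prodMk (measurable_pi_lambda _ fun u ↦ measurable_pathArg_prod κ (min u T))

/-- On the Brownian path the universal stopped pair is the canonical one. [folklore] -/
theorem pathStopPair_brownian (T : ℝ≥0) (p : ℝ × (ℝ≥0 → ℝ)) :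
    pathStopPair κ T (p.1, fun u ↦ brownian u p.2) = flowStopPair κ T p := by
  simp only [pathStopPair, flowStopPair, pathArg_brownian]

/-- **The image of `m ⊗ 𝓦` under the universal stopped flow is the image of `m ⊗ W` under the
canonical one** (`𝓦` = law of the Brownian path). [folklore] -/
theorem map_pathStopPair_prod_eq (m : Measure ℝ) [SFinite m] (T : ℝ≥0) :
    (m.prod (preWienerMeasure.map fun ω u ↦ brownian u ω)).map (pathStopPair κ T) =
      (m.prod preWienerMeasure).map (flowStopPair κ T) := by
  haveI := isProbabilityMeasure_preWienerMeasure'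
  have h1 : m.prod (preWienerMeasure.map fun ω u ↦ brownian u ω) =
      (m.prod preWienerMeasure).map (Prod.map id fun ω u ↦ brownian u ω) := by
    rw [← Measure.map_prod_map m preWienerMeasure measurable_id measurable_brownian_pi, Measure.map_id]
  rw [h1, Measure.map_map (measurable_pathStopPair κ T) (measurable_id.prodMap measurable_brownian_pi)]
  congr 1
  funext p
  exact pathStopPair_brownian T p

end Pairs

/-! ### The driving increment, its exit data and the concatenated Brownian motion -/

section Concat

variable (κ)

/-- The band half-width `ε_n = π/(n+4)`. [folklore] -/
def bandWidth (n : ℕ) : ℝ := π / (n + 4)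

/-- The exit time `τ_n` of `|X - π|` above `π - 2ε_n` (an optional time of the past filtration).
[folklore] -/
def bandExitTime (n : ℕ) : C(ℝ, ℝ) → WithTop ℝ≥0 :=
  ratExceed (fun (t : ℝ≥0) (x : C(ℝ, ℝ)) ↦ |coordProc t x - π|) (π - 2 * bandWidth n)

/-- **The normalised driving increment frozen after `T`**:
`ξ'_t = (X_{t∧T} - X_0 - ∫₀^{t∧T} cot(X_u/2) du)/√κ`. [cite: MillerSheffield2013, §2.1.2] -/
def drivingIncr (T : ℝ≥0) (t : ℝ≥0) (x : C(ℝ, ℝ)) : ℝ :=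
  (x (min t T) - x 0 - ∫ u in (0 : ℝ)..(min t T), Real.cot (x u / 2)) / Real.sqrt κ

/-- The capped exit time `σ = τ_n ∧ T`, read in `ℝ≥0`. [folklore] -/
def clockCap (n : ℕ) (T : ℝ≥0) (x : C(ℝ, ℝ)) : ℝ≥0 := (min (T : WithTop ℝ≥0) (bandExitTime n x)).untopA

/-- **The concatenated process** `M_t(x, ω) = -ξ'_{t ∧ τ_n}(x) + (B_t(ω) - B_{t ∧ σ(x)}(ω))`:
minus the stopped driving increment, continued after `σ` by an independent Brownian motion.
[cite: RevuzYor1999, Ch. V Thm (1.7) (proof)] -/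
def concatBM (n : ℕ) (T : ℝ≥0) (t : ℝ≥0) (ω : C(ℝ, ℝ) × (ℝ≥0 → ℝ)) : ℝ :=
  -stoppedProcess (drivingIncr κ T) (bandExitTime n) t ω.1 +
    (brownian t ω.2 - brownian (min t (clockCap n T ω.1)) ω.2)

variable {κ}

/-- `0 < ε_n`. [folklore] -/
theorem bandWidth_pos (n : ℕ) : 0 < bandWidth n := by unfold bandWidth; positivity

/-- `ε_n < π/2`. [folklore] -/
theorem bandWidth_lt (n : ℕ) : bandWidth n < π / 2 :=
  div_lt_div_of_pos_left Real.pi_pos (by norm_num) (by norm_cast; omega)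

/-- The bands grow: `ε_{n+1} ≤ ε_n`. [folklore] -/
theorem bandWidth_succ_le (n : ℕ) : bandWidth (n + 1) ≤ bandWidth n := by
  unfold bandWidth
  refine div_le_div_of_nonneg_left Real.pi_pos.le (by positivity) ?_
  push_cast; linarith

/-- `τ_n` is an optional time of the past filtration. [folklore] -/
theorem isOptionalTime_bandExitTime (n : ℕ) : IsOptionalTime pastFiltration (bandExitTime n) := by
  unfold bandExitTime; exact isOptionalTime_exit _

/-- `σ` is measurable and `t ∧ σ` is adapted. [folklore] -/
theorem measurable_clockCap (n : ℕ) (T : ℝ≥0) : Measurable (clockCap n T) :=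
  ((isOptionalTime_bandExitTime n).measurable_untopA_min T).mono (pastFiltration.le T) le_rfl

/-- `t ∧ σ` is `ℱ_t`-measurable. [folklore] -/
theorem measurable_min_clockCap (n : ℕ) (T t : ℝ≥0) :
    Measurable[pastFiltration t] fun x ↦ min t (clockCap n T x) := by
  have : (fun x ↦ min t (clockCap n T x)) =
      fun x ↦ min (min (t : WithTop ℝ≥0) (bandExitTime n x)).untopA T := by
    funext x; unfold clockCap; rw [min_untopA_min_eq]
  rw [this]
  exact ((isOptionalTime_bandExitTime n).measurable_untopA_min t).min measurable_const

/-- A martingale clock is preserved by negating the process. [folklore] -/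
theorem _root_.Literature.Probability.Process.HasMartingaleClock.neg {Ω : Type*} {m : MeasurableSpace Ω}
    {Y c : ℝ≥0 → Ω → ℝ} {𝓕 : Filtration ℝ≥0 m} {P : Measure Ω} {N : ℝ}
    (h : HasMartingaleClock Y c 𝓕 P N) : HasMartingaleClock (fun t ω ↦ -Y t ω) c 𝓕 P N where
  isAEMartingale := by
    have h1 := h.isAEMartingale.const_mul (-1)
    simpa only [neg_one_mul] using h1
  isAEMartingale_sq_sub := by
    have h1 := h.isAEMartingale_sq_sub
    simpa only [neg_sq] using h1
  clock_zero := h.clock_zero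
  clock_mono := h.clock_mono
  clock_sub_le := h.clock_sub_le
  abs_le := by
    filter_upwards [h.abs_le] with ω hω t
    rw [abs_neg]; exact hω t

/-- **Conditioning on an `ℱ_0`-event preserves the stopped martingale problem.** Under a stationary
SLE_κ(0) angle law `P` and a Borel `A`, the conditioned measure `P[· | X_0 ∈ A]` (a finite
measure) makes `t ↦ N^f_{0, t∧T}` a `pastFiltration`-martingale for every `C²` test function
supported in `(ε, 2π - ε)`. [cite: KaratzasShreve1988, Ch. 5 §4.B] -/
theorem martingale_angleIncrement_cond {P : Measure C(ℝ, ℝ)} (hP : IsStationaryAngleLaw κ 0 P)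
    {A : Set ℝ} (hA : MeasurableSet A) {ε : ℝ} (hε : 0 < ε)
    (T : ℝ≥0) {f : ℝ → ℝ} (hf : ContDiff ℝ 2 f) (hsupp : tsupport f ⊆ Ioo ε (2 * π - ε)) :
    Martingale (fun (t : ℝ≥0) x ↦ angleIncrement κ 0 f 0 (min t T) x) pastFiltration
      (P[|{x | x 0 ∈ A}]) := by
  haveI := hP.isProbabilityMeasure
  set E : Set C(ℝ, ℝ) := {x | x 0 ∈ A} with hE
  have hsupp' : tsupport f ⊆ Ioo 0 (2 * π) := hsupp.trans (Ioo_subset_Ioo hε.le (by linarith))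
  have hfc : HasCompactSupport f := hasCompactSupport_of_tsupport_subset_Ioo hsupp
  have hmart := hP.martingale_angleIncrement hf hfc hsupp'
  have hEs : ∀ s : ℝ≥0, MeasurableSet[pastFiltration s] E := fun s ↦
    measurable_eval_angleFiltration (show (0 : ℝ) ≤ (s : ℝ) from s.coe_nonneg) hA
  have heq : (fun (t : ℝ≥0) x ↦ angleIncrement κ 0 f 0 (min t T) x) =
      fun (t : ℝ≥0) x ↦ angleIncrement κ 0 f 0 ((min t T : ℝ≥0) : ℝ) x := by
    funext t x; rw [NNReal.coe_min]
  rw [heq]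
  refine martingale_min_of_setIntegral_eq (Y := fun (r : ℝ≥0) x ↦ angleIncrement κ 0 f 0 r x)
    (fun r ↦ measurable_angleIncrement_angleFiltration hf hsupp' r.coe_nonneg)
    (fun r ↦ ?_) fun s t hst _ B hB ↦ ?_
  · obtain ⟨C, -, hC⟩ := exists_bound_angleIncrement (κ := κ) (ρ := 0) hf hfc hsupp' 0 r
    exact ⟨C, hC⟩
  · have hBm : MeasurableSet B := (pastFiltration.le s) _ hB
    have hBE : MeasurableSet[pastFiltration s] (B ∩ E) := hB.inter (hEs s)
    show ∫ x in B, angleIncrement κ 0 f 0 t x ∂(P[|E]) = ∫ x in B, angleIncrement κ 0 f 0 s x ∂(P[|E])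
    rw [ProbabilityTheory.cond, Measure.restrict_smul, integral_smul_measure, integral_smul_measure,
      Measure.restrict_restrict hBm, ← hmart.setIntegral_eq hst hBE]

variable (κ) in
/-- **The concatenation is a Brownian motion under every conditioned measure.** For a stationary
SLE_κ(0) angle law `P` (`0 < κ`), `A` Borel with `P(X_0 ∈ A) ≠ 0`, the process `concatBM κ n T` is a
real Brownian motion on `(C(ℝ, ℝ) × Ω₀, P[· | X_0 ∈ A] ⊗ W)` (martingale clock of the stopped driving
increment, `hasMartingaleClock_drivingIncrement_of_martingale`; concatenation,
`isBrownianReal_concat`). [cite: RevuzYor1999, Ch. V Thm (1.7) (proof)] -/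
theorem isBrownianReal_concatBM_cond {P : Measure C(ℝ, ℝ)} (hP : IsStationaryAngleLaw κ 0 P)
    (hκ : 0 < κ) {A : Set ℝ} (hA : MeasurableSet A) (hA0 : P {x | x 0 ∈ A} ≠ 0) (n : ℕ) (T : ℝ≥0) :
    IsBrownianReal (concatBM κ n T) ((P[|{x | x 0 ∈ A}]).prod preWienerMeasure) ∧
      (∀ t, Measurable (concatBM κ n T t)) ∧ ∀ ω, Continuous (concatBM κ n T · ω) := by
  haveI := hP.isProbabilityMeasure
  haveI : IsProbabilityMeasure (P[|{x | x 0 ∈ A}]) := cond_isProbabilityMeasure hA0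
  set Q : Measure C(ℝ, ℝ) := P[|{x | x 0 ∈ A}] with hQ
  obtain ⟨hYc, hYad, N, hclk⟩ := hasMartingaleClock_drivingIncrement_of_martingale Q hκ
    (bandWidth_pos n) (bandWidth_lt n) T
    (fun f hf hsupp ↦ martingale_angleIncrement_cond hP hA (bandWidth_pos n) T hf hsupp)
  -- read the tree's stopped increment and exit time as `drivingIncr`, `bandExitTime`
  have hτ_def : ratExceed (fun (t : ℝ≥0) (x : C(ℝ, ℝ)) ↦ |coordProc t x - π|) (π - 2 * bandWidth n) =
      bandExitTime n := rfl
  have hξ_def : (fun (t : ℝ≥0) (x : C(ℝ, ℝ)) ↦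
      (x (min t T) - x 0 - ∫ u in (0 : ℝ)..(min t T), Real.cot (x u / 2)) / Real.sqrt κ) =
      drivingIncr κ T := rfl
  rw [hτ_def, hξ_def] at hYc hYad hclk
  -- the clock in the form `t ∧ σ`
  have hclk' : HasMartingaleClock (stoppedProcess (drivingIncr κ T) (bandExitTime n))
      (fun t x ↦ ((min t (clockCap n T x) : ℝ≥0) : ℝ)) pastFiltration Q N := by
    have hfun : (fun (t : ℝ≥0) (x : C(ℝ, ℝ)) ↦
        ((min (min (t : WithTop ℝ≥0) (bandExitTime n x)).untopA T : ℝ≥0) : ℝ)) =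
        fun t x ↦ ((min t (clockCap n T x) : ℝ≥0) : ℝ) := by
      funext t x; unfold clockCap; rw [min_untopA_min_eq]
    rw [hfun] at hclk
    exact hclk
  have hYneg := hclk'.neg
  have hY0' : ∀ x, stoppedProcess (drivingIncr κ T) (bandExitTime n) 0 x = 0 := by
    intro x
    simp only [stoppedProcess, untopA_min_zero, drivingIncr]
    have : min ((0 : ℝ≥0) : ℝ) (T : ℝ) = 0 := min_eq_left T.coe_nonneg
    rw [NNReal.coe_zero] at this ⊢
    rw [this]
    simp
  have hY0 : ∀ x, (fun (t : ℝ≥0) (x : C(ℝ, ℝ)) ↦ -stoppedProcess (drivingIncr κ T) (bandExitTime n) t x) 0 x = 0 :=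
    fun x ↦ by show -stoppedProcess (drivingIncr κ T) (bandExitTime n) 0 x = 0; rw [hY0', neg_zero]
  have hYnc : ∀ x, Continuous fun t ↦
      (fun (t : ℝ≥0) (x : C(ℝ, ℝ)) ↦ -stoppedProcess (drivingIncr κ T) (bandExitTime n) t x) t x :=
    fun x ↦ continuous_neg.comp (hYc x)
  have hYnad : ∀ t, StronglyMeasurable[pastFiltration t]
      ((fun (t : ℝ≥0) (x : C(ℝ, ℝ)) ↦ -stoppedProcess (drivingIncr κ T) (bandExitTime n) t x) t) :=
    fun t ↦ (hYad t).neg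
  have hM : concatBM κ n T = fun t ω ↦
      (fun (t : ℝ≥0) (x : C(ℝ, ℝ)) ↦ -stoppedProcess (drivingIncr κ T) (bandExitTime n) t x) t ω.1 +
        (brownian t ω.2 - brownian (min t (clockCap n T ω.1)) ω.2) := by
    funext t ω; rfl
  refine ⟨isBrownianReal_concat hYneg hYnc hYnad (measurable_clockCap n T)
    (measurable_min_clockCap n T) hY0 hM, measurable_concat hM hYnad (measurable_min_clockCap n T),
    continuous_concat hM hYnc⟩

/-- **The law of the pair `(X_0, M)` is the product `m ⊗ 𝓦`** (`m` the time-`0` marginal, `𝓦` the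
law of the Brownian path): for every Borel `A`, conditionally on `{X_0 ∈ A}` the concatenation is a
Brownian motion, so `P ⊗ W (X_0 ∈ A, M ∈ S) = m(A) 𝓦(S)`, and a measure on a product is
determined by its values on rectangles (`Measure.prod_eq`). [cite: RevuzYor1999, Ch. V Thm (1.7)] -/
theorem map_pair_concatBM_eq {P : Measure C(ℝ, ℝ)} (hP : IsStationaryAngleLaw κ 0 P) (hκ : 0 < κ)
    (n : ℕ) (T : ℝ≥0) :
    (P.prod preWienerMeasure).map (fun ω ↦ (ω.1 0, fun t ↦ concatBM κ n T t ω)) =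
      (P.map fun x : C(ℝ, ℝ) ↦ x 0).prod (preWienerMeasure.map fun ω u ↦ brownian u ω) := by
  haveI := hP.isProbabilityMeasure
  haveI := isProbabilityMeasure_preWienerMeasure'
  obtain ⟨-, hMm, -⟩ := isBrownianReal_concatBM_cond κ hP hκ MeasurableSet.univ (by simp) n T
  have hpath : Measurable fun ω : C(ℝ, ℝ) × (ℝ≥0 → ℝ) ↦ fun t ↦ concatBM κ n T t ω :=
    measurable_pi_lambda _ hMm
  have hΨ : Measurable fun ω : C(ℝ, ℝ) × (ℝ≥0 → ℝ) ↦ (ω.1 0, fun t ↦ concatBM κ n T t ω) :=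
    ((continuous_eval_const (0 : ℝ)).measurable.comp measurable_fst).prodMk hpath
  have hev : Measurable fun x : C(ℝ, ℝ) ↦ x 0 := (continuous_eval_const (0 : ℝ)).measurable
  haveI : IsProbabilityMeasure (P.map fun x : C(ℝ, ℝ) ↦ x 0) :=
    Measure.isProbabilityMeasure_map hev.aemeasurable
  haveI : IsProbabilityMeasure (preWienerMeasure.map fun ω u ↦ brownian u ω) :=
    Measure.isProbabilityMeasure_map measurable_brownian_pi.aemeasurable
  symm
  refine Measure.prod_eq fun A S hA hS ↦ ?_
  set E : Set C(ℝ, ℝ) := {x | x 0 ∈ A} with hE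
  have hEm : MeasurableSet E := hev hA
  have hpre : (fun ω : C(ℝ, ℝ) × (ℝ≥0 → ℝ) ↦ (ω.1 0, fun t ↦ concatBM κ n T t ω)) ⁻¹' (A ×ˢ S) =
      (fun ω : C(ℝ, ℝ) × (ℝ≥0 → ℝ) ↦ fun t ↦ concatBM κ n T t ω) ⁻¹' S ∩ E ×ˢ (univ : Set (ℝ≥0 → ℝ)) := by
    ext ω
    simp only [mem_preimage, mem_prod, mem_inter_iff, mem_univ, and_true, hE, mem_setOf_eq]
    exact and_comm
  rw [Measure.map_apply hΨ (hA.prod hS), hpre, Measure.map_apply hev hA]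
  change (P.prod preWienerMeasure) (_ ∩ E ×ˢ univ) = P E * _
  by_cases hE0 : P E = 0
  · rw [hE0, zero_mul]
    refine le_antisymm ((measure_mono inter_subset_right).trans ?_) bot_le
    rw [Measure.prod_prod, hE0, zero_mul]
  · -- conditionally on `E` the concatenation is a Brownian motion
    obtain ⟨hBM, -, -⟩ := isBrownianReal_concatBM_cond κ hP hκ hA hE0 n T
    have hlaw : ((P[|E]).prod preWienerMeasure).map (fun ω t ↦ concatBM κ n T t ω) =
        preWienerMeasure.map (fun ω u ↦ brownian u ω) :=
      hBM.toIsPreBrownianReal.map_path_eq isPreBrownianReal_brownian hMm measurable_brownian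
    have h1 : ((P[|E]).prod preWienerMeasure)
        ((fun ω : C(ℝ, ℝ) × (ℝ≥0 → ℝ) ↦ fun t ↦ concatBM κ n T t ω) ⁻¹' S) =
        (preWienerMeasure.map fun ω u ↦ brownian u ω) S := by
      rw [← hlaw, Measure.map_apply hpath hS]
    rw [ProbabilityTheory.cond, Measure.prod_smul_left, Measure.restrict_prod_eq_prod_univ, Measure.smul_apply,
      Measure.restrict_apply (hpath hS), smul_eq_mul] at h1
    rw [← h1, ← mul_assoc, ENNReal.mul_inv_cancel hE0 (measure_ne_top _ _), one_mul]

/-- **The flow identity on the band event.** If `|x - π| ≤ π - 2ε_n` on `[0, T]`, then for every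
Brownian sample `ω` and every `u ≤ T`, `x_u` is the universal radial Bessel flow started from `x_0`
and driven by the concatenated path: `x_u = pathArg κ x₀ u M(x, ω)`. [folklore] -/
theorem eq_pathArg_concatBM (hκ : 0 < κ) {n : ℕ} {T : ℝ≥0} {x : C(ℝ, ℝ)}
    (hband : ∀ u ∈ Icc (0 : ℝ) T, |x u - π| ≤ π - 2 * bandWidth n)
    (hMc : ∀ ω : C(ℝ, ℝ) × (ℝ≥0 → ℝ), Continuous (concatBM κ n T · ω)) (ω : ℝ≥0 → ℝ) :
    ∀ u : ℝ≥0, u ≤ T → x u = pathArg κ (x 0) u fun t ↦ concatBM κ n T t (x, ω) := by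
  have hτ : ((T : ℝ≥0) : WithTop ℝ≥0) ≤ bandExitTime n x := coe_le_exit_of_forall hband
  have hσ : clockCap n T x = T := untopA_min_of_le hτ
  have hsqrt : Real.sqrt κ ≠ 0 := (Real.sqrt_pos.2 (by exact_mod_cast hκ)).ne'
  -- before `T` the concatenation is minus the driving increment
  have hM : ∀ t : ℝ≥0, t ≤ T → concatBM κ n T t (x, ω) =
      -((x t - x 0 - ∫ u in (0 : ℝ)..t, Real.cot (x u / 2)) / Real.sqrt κ) := by
    intro t ht
    have ht' : ((t : ℝ≥0) : WithTop ℝ≥0) ≤ bandExitTime n x := (WithTop.coe_le_coe.2 ht).trans hτ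
    unfold concatBM
    simp only
    rw [hσ, min_eq_left ht, sub_self, add_zero, stoppedProcess_eq_of_le ht', drivingIncr]
    simp only [min_eq_left (NNReal.coe_le_coe.2 ht)]
  have hM0 : concatBM κ n T 0 (x, ω) = 0 := by
    rw [hM 0 bot_le]; simp
  have hy : Continuous fun u : ℝ≥0 ↦ x u := x.continuous.comp NNReal.continuous_coe
  have h := eq_pathArg_of_integral_eq (κ := κ) (hMc (x, ω)) hy (bandWidth_pos n) (bandWidth_lt n).le
    (T := T) (fun u hu ↦ hband u ⟨u.coe_nonneg, NNReal.coe_le_coe.2 hu⟩) fun u hu ↦ ?_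
  · simpa using h
  · rw [hM u hu, hM0, sub_zero]
    have e : ∫ r in (0 : ℝ)..u, Real.cot (x ↑(r.toNNReal) / 2) = ∫ r in (0 : ℝ)..u, Real.cot (x r / 2) := by
      refine intervalIntegral.integral_congr fun r hr ↦ ?_
      rw [uIcc_of_le (NNReal.coe_nonneg u)] at hr
      simp only [Real.coe_toNNReal _ hr.1]
    simp only [NNReal.coe_zero] at e ⊢
    rw [e]
    field_simp
    ring

end Concat

/-! ### The law of the stopped path -/

section StoppedLaw

/-- The band events `Gₙ = {|x - π| ≤ π - 2εₙ on [0, T]}` are closed. [folklore] -/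
theorem isClosed_bandEvent (n : ℕ) (T : ℝ≥0) :
    IsClosed {x : C(ℝ, ℝ) | ∀ u ∈ Icc (0 : ℝ) T, |x u - π| ≤ π - 2 * bandWidth n} := by
  have h : {x : C(ℝ, ℝ) | ∀ u ∈ Icc (0 : ℝ) T, |x u - π| ≤ π - 2 * bandWidth n} =
      ⋂ u ∈ Icc (0 : ℝ) T, {x : C(ℝ, ℝ) | |x u - π| ≤ π - 2 * bandWidth n} := by
    ext x; simp only [mem_setOf_eq, mem_iInter]
  rw [h]
  exact isClosed_biInter fun u _ ↦ isClosed_le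
    (continuous_abs.comp ((continuous_eval_const u).sub continuous_const)) continuous_const

/-- The band events are increasing in `n`. [folklore] -/
theorem bandEvent_mono (T : ℝ≥0) :
    Monotone fun n : ℕ ↦ {x : C(ℝ, ℝ) | ∀ u ∈ Icc (0 : ℝ) T, |x u - π| ≤ π - 2 * bandWidth n} := by
  refine monotone_nat_of_le_succ fun n x hx u hu ↦ (hx u hu).trans ?_
  linarith [bandWidth_succ_le n]

/-- **The band events exhaust the path space** a.s. under a law whose paths stay in `(0, 2π)`.
[folklore] -/
theorem tendsto_measure_bandEvent {P : Measure C(ℝ, ℝ)} [IsProbabilityMeasure P]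
    (hIoo : ∀ᵐ x ∂P, ∀ t : ℝ, x t ∈ Ioo 0 (2 * π)) (T : ℝ≥0) :
    Tendsto (fun n : ℕ ↦ P {x : C(ℝ, ℝ) | ∀ u ∈ Icc (0 : ℝ) T, |x u - π| ≤ π - 2 * bandWidth n})
      atTop (𝓝 1) := by
  have h := tendsto_measure_iUnion_atTop (μ := P) (bandEvent_mono T)
  have hfull : P (⋃ n : ℕ, {x : C(ℝ, ℝ) | ∀ u ∈ Icc (0 : ℝ) T, |x u - π| ≤ π - 2 * bandWidth n}) = 1 := by
    refine le_antisymm prob_le_one ?_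
    rw [← measure_univ (μ := P)]
    refine measure_mono_ae ?_
    filter_upwards [hIoo] with x hx _
    obtain ⟨n, hn⟩ := exists_forall_abs_sub_pi_le (T := T) (x := x) fun u _ ↦ hx u
    exact mem_iUnion.2 ⟨n, hn⟩
  rw [hfull] at h
  exact h

/-- **The law of `(X_0, X_{·∧T})` under a stationary SLE_κ(0) angle law** (`0 < κ ≤ 4`): it is the
image of `m ⊗ W` under the stopped SLE_κ radial Bessel flow `(θ, ω) ↦ (θ, Y^θ_{·∧T}(ω))`, `m` the
time-`0` marginal. (Steps 1–3 of the module docstring: product law of `(X_0, M)`, flow identity on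
the band events, and their exhaustion.) [cite: KaratzasShreve1988, Ch. 5 §4.B Cor. 4.9] -/
theorem map_stopPair_eq {P : Measure C(ℝ, ℝ)} (hP : IsStationaryAngleLaw κ 0 P) (hκ : 0 < κ)
    (T : ℝ≥0) :
    P.map (stopPair T) =
      ((P.map fun x : C(ℝ, ℝ) ↦ x 0).prod preWienerMeasure).map (flowStopPair κ T) := by
  haveI := hP.isProbabilityMeasure
  haveI := isProbabilityMeasure_preWienerMeasure'
  set m : Measure ℝ := P.map fun x : C(ℝ, ℝ) ↦ x 0 with hm
  have hev : Measurable fun x : C(ℝ, ℝ) ↦ x 0 := (continuous_eval_const (0 : ℝ)).measurable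
  haveI : IsProbabilityMeasure m := Measure.isProbabilityMeasure_map hev.aemeasurable
  set 𝓦 : Measure (ℝ≥0 → ℝ) := preWienerMeasure.map fun ω u ↦ brownian u ω with h𝓦
  haveI : IsProbabilityMeasure 𝓦 := Measure.isProbabilityMeasure_map measurable_brownian_pi.aemeasurable
  rw [← map_pathStopPair_prod_eq m T]
  ext S hS
  rw [Measure.map_apply (measurable_stopPair T) hS, Measure.map_apply (measurable_pathStopPair κ T) hS]
  -- the band events
  set G : ℕ → Set C(ℝ, ℝ) := fun n ↦
    {x : C(ℝ, ℝ) | ∀ u ∈ Icc (0 : ℝ) T, |x u - π| ≤ π - 2 * bandWidth n} with hG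
  have hGm : ∀ n, MeasurableSet (G n) := fun n ↦ (isClosed_bandEvent n T).measurableSet
  have hGlim : Tendsto (fun n ↦ P (G n)ᶜ) atTop (𝓝 0) := by
    have h1 : Tendsto (fun n ↦ P (G n)) atTop (𝓝 1) := tendsto_measure_bandEvent hP.2.1 T
    have h2 : (fun n ↦ P (G n)ᶜ) = fun n ↦ 1 - P (G n) := by
      funext n; rw [prob_compl_eq_one_sub (hGm n)]
    rw [h2]
    have h3 := ENNReal.Tendsto.sub (tendsto_const_nhds (x := (1 : ℝ≥0∞))) h1 (Or.inl ENNReal.one_ne_top)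
    rwa [tsub_self] at h3
  -- for each `n`, compare the two preimages on `G n × Ω₀`
  set R : ℝ≥0∞ := (m.prod 𝓦) (pathStopPair κ T ⁻¹' S) with hR
  have hkey : ∀ n : ℕ, P (stopPair T ⁻¹' S) ≤ R + P (G n)ᶜ ∧ R ≤ P (stopPair T ⁻¹' S) + P (G n)ᶜ := by
    intro n
    obtain ⟨-, hMm, hMc⟩ := isBrownianReal_concatBM_cond κ hP hκ MeasurableSet.univ (by simp) n T
    set Ψ : C(ℝ, ℝ) × (ℝ≥0 → ℝ) → ℝ × (ℝ≥0 → ℝ) := fun ω ↦ (ω.1 0, fun t ↦ concatBM κ n T t ω) with hΨ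
    have hΨm : Measurable Ψ := (hev.comp measurable_fst).prodMk (measurable_pi_lambda _ hMm)
    have hlaw : (P.prod preWienerMeasure).map Ψ = m.prod 𝓦 := map_pair_concatBM_eq hP hκ n T
    -- the two preimages in the product space
    set U₁ : Set (C(ℝ, ℝ) × (ℝ≥0 → ℝ)) := (stopPair T ⁻¹' S) ×ˢ univ with hU₁
    set U₂ : Set (C(ℝ, ℝ) × (ℝ≥0 → ℝ)) := (pathStopPair κ T ∘ Ψ) ⁻¹' S with hU₂
    have hU₁P : (P.prod preWienerMeasure) U₁ = P (stopPair T ⁻¹' S) := by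
      rw [hU₁, Measure.prod_prod, measure_univ, mul_one]
    have hU₂R : (P.prod preWienerMeasure) U₂ = R := by
      rw [hU₂, preimage_comp, ← Measure.map_apply hΨm ((measurable_pathStopPair κ T) hS), hlaw]
    have hGc : (P.prod preWienerMeasure) ((G n)ᶜ ×ˢ (univ : Set (ℝ≥0 → ℝ))) = P (G n)ᶜ := by
      rw [Measure.prod_prod, measure_univ, mul_one]
    -- on `G n × Ω₀` the two events agree
    have hagree : ∀ ω : C(ℝ, ℝ) × (ℝ≥0 → ℝ), ω.1 ∈ G n → (ω ∈ U₁ ↔ ω ∈ U₂) := by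
      rintro ⟨x, w⟩ hx
      have hflow := eq_pathArg_concatBM hκ hx hMc w
      have heq : stopPair T x = pathStopPair κ T (Ψ (x, w)) := by
        simp only [stopPair, pathStopPair, hΨ]
        refine Prod.ext rfl (funext fun u ↦ ?_)
        have := hflow (min u T) (min_le_right u T)
        simpa using this
      simp only [hU₁, hU₂, mem_prod, mem_univ, and_true, mem_preimage, Function.comp_apply, heq]
    have hsub₁ : U₁ ⊆ U₂ ∪ (G n)ᶜ ×ˢ (univ : Set (ℝ≥0 → ℝ)) := by
      intro ω hω
      by_cases hx : ω.1 ∈ G n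
      · exact Or.inl ((hagree ω hx).1 hω)
      · exact Or.inr ⟨hx, mem_univ _⟩
    have hsub₂ : U₂ ⊆ U₁ ∪ (G n)ᶜ ×ˢ (univ : Set (ℝ≥0 → ℝ)) := by
      intro ω hω
      by_cases hx : ω.1 ∈ G n
      · exact Or.inl ((hagree ω hx).2 hω)
      · exact Or.inr ⟨hx, mem_univ _⟩
    constructor
    · rw [← hU₁P, ← hU₂R, ← hGc]
      exact (measure_mono hsub₁).trans (measure_union_le _ _)
    · rw [← hU₁P, ← hU₂R, ← hGc]
      exact (measure_mono hsub₂).trans (measure_union_le _ _)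
  -- let `n → ∞`
  have hlim1 : Tendsto (fun n : ℕ ↦ R + P (G n)ᶜ) atTop (𝓝 R) := by
    simpa using (tendsto_const_nhds (x := R)).add hGlim
  have hlim2 : Tendsto (fun n : ℕ ↦ P (stopPair T ⁻¹' S) + P (G n)ᶜ) atTop
      (𝓝 (P (stopPair T ⁻¹' S))) := by
    simpa using (tendsto_const_nhds (x := P (stopPair T ⁻¹' S))).add hGlim
  refine le_antisymm (ge_of_tendsto' hlim1 fun n ↦ (hkey n).1) (ge_of_tendsto' hlim2 fun n ↦ (hkey n).2)

end StoppedLaw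

/-! ### The one-sided law, the invariant marginal, uniqueness -/

section Unique

/-- **The law of `(X_u)_{u ≥ 0}` under a stationary SLE_κ(0) angle law is the flow law of its
time-`0` marginal** (`0 < κ ≤ 4`): finite-dimensional laws from `map_stopPair_eq`, and
`measure_continuousMap_ext_of_fdd`. [cite: KaratzasShreve1988, Ch. 5 §4.B Cor. 4.9] -/
theorem map_restrictPath_eq_flowLaw {P : Measure C(ℝ, ℝ)} (hP : IsStationaryAngleLaw κ 0 P)
    (hκ : 0 < κ) (hκ4 : κ ≤ 4) :
    P.map restrictPath = flowLaw κ (P.map fun x : C(ℝ, ℝ) ↦ x 0) := by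
  haveI := hP.isProbabilityMeasure
  haveI := isProbabilityMeasure_preWienerMeasure'
  set m : Measure ℝ := P.map fun x : C(ℝ, ℝ) ↦ x 0 with hm
  have hev : Measurable fun x : C(ℝ, ℝ) ↦ x 0 := (continuous_eval_const (0 : ℝ)).measurable
  haveI : IsProbabilityMeasure m := Measure.isProbabilityMeasure_map hev.aemeasurable
  have hmIoo : ∀ᵐ θ ∂m, θ ∈ Ioo 0 (2 * π) := by
    refine (ae_map_iff hev.aemeasurable measurableSet_Ioo).2 ?_
    filter_upwards [hP.2.1] with x hx using hx 0
  haveI : IsProbabilityMeasure (P.map restrictPath) :=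
    Measure.isProbabilityMeasure_map measurable_restrictPath.aemeasurable
  refine measure_continuousMap_ext_of_fdd fun I ↦ ?_
  -- a horizon beyond the times of `I`
  set T : ℝ≥0 := I.sup id with hT
  have hIT : ∀ i ∈ I, i ≤ T := fun i hi ↦ Finset.le_sup (f := id) hi
  have hproj : Measurable fun (f : C(ℝ≥0, ℝ)) (i : I) ↦ f i :=
    measurable_pi_lambda _ fun i ↦ measurable_eval_oneSided (i : ℝ≥0)
  -- both sides as images of `m ⊗ W`
  set πI : ℝ × (ℝ≥0 → ℝ) → (I → ℝ) := fun q i ↦ q.2 i with hπI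
  have hπIm : Measurable πI := measurable_pi_lambda _ fun i ↦ (measurable_pi_apply _).comp measurable_snd
  have h1 : (fun (f : C(ℝ≥0, ℝ)) (i : I) ↦ f i) ∘ restrictPath = πI ∘ stopPair T := by
    funext x; funext i
    simp only [Function.comp_apply, restrictPath_apply, hπI, stopPair]
    rw [min_eq_left (NNReal.coe_le_coe.2 (hIT i i.2))]
  have h2 : ∀ᵐ p ∂(m.prod preWienerMeasure),
      ((fun (f : C(ℝ≥0, ℝ)) (i : I) ↦ f i) ∘ flowPath κ) p = (πI ∘ flowStopPair κ T) p := by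
    filter_upwards [ae_mem_argGood hκ4 hmIoo] with p hp
    funext i
    simp only [Function.comp_apply, hπI, flowStopPair, min_eq_left (hIT i i.2)]
    exact argPath_apply_of_mem _ hp _
  rw [Measure.map_map hproj measurable_restrictPath, h1,
    ← Measure.map_map hπIm (measurable_stopPair T), map_stopPair_eq hP hκ T,
    Measure.map_map hπIm (measurable_flowStopPair κ T), flowLaw,
    Measure.map_map hproj (measurable_flowPath κ), Measure.map_congr h2]

/-- **The time-`0` marginal of a stationary SLE_κ(0) angle law is invariant** for the transition
kernels of the SLE_κ radial Bessel process (`0 < κ ≤ 4`). [cite: MillerSheffield2013, Prop. 2.1] -/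
theorem bind_sleKernel_marginal_eq {P : Measure C(ℝ, ℝ)} (hP : IsStationaryAngleLaw κ 0 P)
    (hκ : 0 < κ) (hκ4 : κ ≤ 4) (t : ℝ≥0) :
    (P.map fun x : C(ℝ, ℝ) ↦ x 0).bind (sleKernel κ t) = P.map fun x : C(ℝ, ℝ) ↦ x 0 := by
  haveI := hP.isProbabilityMeasure
  have hev : ∀ r : ℝ, Measurable fun x : C(ℝ, ℝ) ↦ x r := fun r ↦ (continuous_eval_const r).measurable
  haveI : IsProbabilityMeasure (P.map fun x : C(ℝ, ℝ) ↦ x 0) :=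
    Measure.isProbabilityMeasure_map (hev 0).aemeasurable
  have hmIoo : ∀ᵐ θ ∂(P.map fun x : C(ℝ, ℝ) ↦ x 0), θ ∈ Ioo 0 (2 * π) := by
    refine (ae_map_iff (hev 0).aemeasurable measurableSet_Ioo).2 ?_
    filter_upwards [hP.2.1] with x hx using hx 0
  rw [← map_eval_flowLaw hκ4 hmIoo t, ← map_restrictPath_eq_flowLaw hP hκ hκ4,
    Measure.map_map (measurable_eval_oneSided t) measurable_restrictPath]
  have h1 : (fun z : C(ℝ≥0, ℝ) ↦ z t) ∘ restrictPath = (fun x : C(ℝ, ℝ) ↦ x 0) ∘ timeShift (t : ℝ) := by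
    funext x; simp
  rw [h1, ← Measure.map_map (hev 0) (measurable_timeShift _), hP.map_timeShift]

/-- The clamps of a stationary law are determined by its one-sided law:
`P ∘ (clampPath N)⁻¹ = (P ∘ restrictPath⁻¹) ∘ (extendPath N)⁻¹`. [folklore] -/
theorem map_clampPath_eq_of_stationary {P : Measure C(ℝ, ℝ)} (hshift : ∀ s : ℝ, P.map (timeShift s) = P)
    (N : ℕ) : P.map (clampPath N) = (P.map restrictPath).map (extendPath N) := by
  have h1 : (clampPath N : C(ℝ, ℝ) → C(ℝ, ℝ)) = (extendPath N ∘ restrictPath) ∘ timeShift (-(N : ℝ)) := by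
    funext x; ext t
    simp only [clampPath_apply, Function.comp_apply, extendPath_apply, restrictPath_apply,
      timeShift_apply, Real.coe_toNNReal']
    congr 1
    rcases le_total (t + N) 0 with h | h
    · rw [max_eq_right (show t ≤ -(N : ℝ) by linarith), max_eq_right h]; ring
    · rw [max_eq_left (show -(N : ℝ) ≤ t by linarith), max_eq_left h]; ring
  rw [h1, ← Measure.map_map ((measurable_extendPath N).comp measurable_restrictPath)
    (measurable_timeShift _), hshift, Measure.map_map (measurable_extendPath N) measurable_restrictPath]

/-- **Uniqueness of the stationary SLE_κ(0) angle law** (`0 < κ ≤ 4`): two stationary angle laws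
coincide. Their time-`0` marginals are invariant probability measures on `(0, 2π)`, hence equal
(`invariant_sleKernel_unique`); so their one-sided laws (`map_restrictPath_eq_flowLaw`) and their
clamps agree, and `Measure.ext_of_map_clampPath` applies. This is uniqueness in law of the
stationary solution, Miller–Sheffield (2013), Prop. 2.1. [cite: MillerSheffield2013, Prop. 2.1] -/
theorem isStationaryAngleLaw_unique (hκ : 0 < κ) (hκ4 : κ ≤ 4) {P P' : Measure C(ℝ, ℝ)}
    (hP : IsStationaryAngleLaw κ 0 P) (hP' : IsStationaryAngleLaw κ 0 P') : P = P' := by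
  haveI := hP.isProbabilityMeasure
  haveI := hP'.isProbabilityMeasure
  have hev : Measurable fun x : C(ℝ, ℝ) ↦ x 0 := (continuous_eval_const (0 : ℝ)).measurable
  haveI : IsProbabilityMeasure (P.map fun x : C(ℝ, ℝ) ↦ x 0) :=
    Measure.isProbabilityMeasure_map hev.aemeasurable
  haveI : IsProbabilityMeasure (P'.map fun x : C(ℝ, ℝ) ↦ x 0) :=
    Measure.isProbabilityMeasure_map hev.aemeasurable
  have hIoo : ∀ {Q : Measure C(ℝ, ℝ)}, IsStationaryAngleLaw κ 0 Q →
      ∀ᵐ θ ∂(Q.map fun x : C(ℝ, ℝ) ↦ x 0), θ ∈ Ioo 0 (2 * π) := fun hQ ↦ by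
    refine (ae_map_iff hev.aemeasurable measurableSet_Ioo).2 ?_
    filter_upwards [hQ.2.1] with x hx using hx 0
  have hm : (P.map fun x : C(ℝ, ℝ) ↦ x 0) = P'.map fun x : C(ℝ, ℝ) ↦ x 0 :=
    invariant_sleKernel_unique hκ4 (hIoo hP) (hIoo hP') (bind_sleKernel_marginal_eq hP hκ hκ4)
      (bind_sleKernel_marginal_eq hP' hκ hκ4)
  have hr : P.map restrictPath = P'.map restrictPath := by
    rw [map_restrictPath_eq_flowLaw hP hκ hκ4, map_restrictPath_eq_flowLaw hP' hκ hκ4, hm]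
  refine Measure.ext_of_map_clampPath fun N ↦ ?_
  rw [map_clampPath_eq_of_stationary hP.map_timeShift, map_clampPath_eq_of_stationary hP'.map_timeShift, hr]

/-- **Existence and uniqueness of the stationary SLE_κ(0) angle law for `0 < κ ≤ 4`.**
[cite: MillerSheffield2013, Prop. 2.1] -/
theorem exists_unique_rho_zero (κ : ℝ≥0) (hκ : 0 < κ) (hκ4 : κ ≤ 4) :
    ∃! P : Measure C(ℝ, ℝ), IsStationaryAngleLaw κ 0 P := by
  obtain ⟨P, hP⟩ := exists_isStationaryAngleLaw_rho_zero hκ hκ4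
  exact ⟨P, hP, fun P' hP' ↦ isStationaryAngleLaw_unique hκ hκ4 hP' hP⟩

/-- **Miller–Sheffield (2013), Prop. 2.1 — the named fact `IsStationaryAngleLaw.exists_unique`
holds**: in the non-hitting regime `κ ≤ 2(ρ + 2)` there is exactly one stationary SLE_κ(ρ) angle
law. Reduction to `ρ = 0`, `0 < κ ≤ 4` by time scaling (`exists_unique_of_rho_zero`), existence by
Krylov–Bogoliubov + Kolmogorov (`StationaryAngleLawExistence`), uniqueness by the martingale
problem ⟹ Brownian driving noise ⟹ pathwise flow ⟹ unique invariant marginal (this file).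
[cite: MillerSheffield2013, Prop. 2.1] -/
theorem IsStationaryAngleLaw.exists_unique_holds : IsStationaryAngleLaw.exists_unique :=
  IsStationaryAngleLaw.exists_unique_of_rho_zero fun κ hκ hκ4 ↦ exists_unique_rho_zero κ hκ hκ4

end Unique

end Literature.Probability.RandomPlanarGeometry
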